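import Literature.MathematicalPhysics.QuantumFieldTheory.Balaban1983to89.BlockAveragingEMLProp1L1
import Literature.MathematicalPhysics.QuantumFieldTheory.Balaban1983to89.B10StarCount

/-!
# `Balaban1983to89.BlockAveragingEMLProp1Iter` — [Balaban1985UV3] (69) FOR THE `n`-FOLD SYMMETRIC AVERAGING (0.4) OF [Balaban1987RG1] WITH THE PRINTED `exp[mean log]`:
# the coarse plaquette of the `n`-fold averaged field is within a WEIGHTED SUM of the finest plaquette sizes plus second order, the weights forming a TRANSPORT PLAN
# (outgoing total `L^{2n}`, incoming total `L^{−(d−2)n}`) — the `L¹` chain of ✓`BlockAveragingEMLProp1L1` carried through `n` levels with print's multiplicity count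

T. Bałaban, *Ultraviolet stability of three-dimensional lattice pure gauge field theories*, Commun. Math. Phys. **102** (1985) 255–275 [Balaban1985UV3] (cell paper B10;
journal page = PDF page + 254), p. 273 (69)–(70): *«Applying the inequalities (50), (53) [4], we have (69) |Ū_k^j(∂p′) − 1| < Σ_{x∈B^j(x₀)} L^{−3j} Σ_{p⊂(p′)_x} |U_k(∂p) − 1| +
O(1)(g_jp(g_j))² … Squaring both sides of the above inequality and using (67) yields (70) |V_j(∂p′) − 1|² < Σ_{x∈B^j(x₀)} L^{−j} Σ_{p⊂(p′)_x} |U_k(∂p) − 1|² + … ≤ 2 Σ_{p⊂Δ′} L^j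
[1 − Re tr U_k(∂p)] + …»*; T. Bałaban, *Averaging operations for lattice gauge theories*, CMP **98** (1985) [Balaban1985Averaging], Prop. 1 (50)–(51) p. 25–26, Prop. 2
(52)–(54) p. 26; T. Bałaban, CMP **109** (1987) [Balaban1987RG1], (0.3)–(0.4) pp. 252–253, p. 253 *«valid universally for all averages satisfying the above properties»*.

Cell `ym3-torus` (rung R3 = SU(2) YM₃ on T³ — NOT d = 4, NOT infinite volume, NOT a mass gap, NOT Clay), width seat «width 8» `ym3-torus-px8` (gen 27),
`--supports stmt-QuantumFields-20520`; HOME `UV3-NODE.md` §69.20 (4)(a) ∕ §69.20-A ∕ §69.20-B: input (a) of the per-large-plaquette small factor (71) for the averaging OF RECORD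
(0.4).  For [B7]'s own linear average (42)–(43) the `j`-fold average FLATTENS as a formula (the translates `(p′)_x`, `x ∈ B^j(x₀)`) and the tree certifies (69)–(71)
(`B10Eq69Concrete`, `B10Eq69TorusPullback`, `B10Eq71TorusLocal`).  The (0.4) iterates do NOT flatten (nonlinear `exp[mean log]`), but the one-step `L¹` bound
(✓`BlockAveragingEMLProp1L1.dist1_plaqHol_avgFun_le_L1`, this seat) CHAINS: this file carries it through `N` levels with the induction invariant that keeps print's
multiplicity constant — the INCOMING-weight identity (every finest plaquette receives total weight `L^{−d}·L²` per level, because given the tiling offsets the base point,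
hence the coarse site, is determined: §1 `sum_sum_tiledSite`), not a sup bound.

WHAT THIS FILE PROVES (kernel, 0 `sorry`, theorems only; no definitions):
* §1 (private) `walkEnd_emb_stairWord_off`, `sum_sum_blockSite` (twins of lit `BlockAveragingEMLLinearised.walkEnd_emb_stairWord_eq_blockSite` ∕
  `B6Ineq2118LowerMultiLevelV1.sum_blockSite_eq`, outside this file's import closure); public ★★`sum_sum_tiledSite` ∕ `sum_tiled_four` (the chain count as a re-indexing identity).
* §2 ★★★`exists_transportWeights` — for successive (0.4)-averages `V_j, …, V_{j+N}` on the torus (standing range), every plaquette of `V_{j+k}` within `a_k` of `1` with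
  `(((d+4)L)²/4)·a_k ≤ δ_N/2` (`k < N`; print: Prop. 2's windows): `∃ W ≥ 0` with `Σ_z W(y,z) ≤ L^{2N}`, `Σ_y W(y,z) ≤ L^{−(d−2)N}` and
  `|V_{j+N}(∂p′_y) − 1| ≤ Σ_z W(y,z)·|V_j(∂p_z) − 1| + Σ_{k<N} L^{2(N−1−k)}·143·((((d+4)L)²/4)·a_k)²` — (69) for (0.4), by induction over the one-step `L¹` bound.
* §3 ★★`sq_weightedSum_le`, ★★`sum_sq_weightedSum_le`, ★★`sq_weightedSum_le_mul` — (70)'s squaring with the plan: per coarse plaquette `(Σ_z W d)² ≤ L^{2N}·L^{−(d−2)N}·Σ_z d_z²`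
  and SUMMED over all coarse plaquettes with the SAME constant (the overlap of the regions `Δ′(p′)` across `p′` is exactly the incoming total — no overlap constant); at `d = 3`
  the factor is print's `L^{N}` (then `|U(∂q) − 1|² ≤ 2[1 − Re tr U(∂q)]` = (11), as in `B10Eq70Squaring` ∕ `B10Eq71TorusLocal.dist1_sq_le_specialUnitaryGroup`, gives (70)'s
  second line and (71) by `B10.eq71_arith`).
NOT HERE: the localisation of `supp W(y, ·)` to a region `Δ′(p′)` (for (0.4) the chains drift: 3 × 3 top blocks in-plane, §69.20-B; the summed form of §3 makes it unnecessary for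
(71)'s «all plaquettes in all large fields set P»); the window bookkeeping feeding `a_k` (Prop. 2 for (0.4): ✓`BlockAveragingEMLProp2.plaqSmall_iter_blockAvg_eml_level`).

HONEST FRAMING.  Kernel lattice bookkeeping + an induction over a landed one-step estimate; nothing else of Bałaban's is asserted; the (m)_E atomic letters of `ym3-torus`'s line
(UV3-NODE §69.20) are NOT discharged by this (it is their input (a); (c), the relative cost of a large-field history, remains the unprinted sentence); no node of any plan is
proved; one finite torus at fixed lattice data — NOT continuum, NOT infinite volume, NOT a mass gap, NOT Clay.  New sibling module; nothing in the tree is modified.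
-/

set_option autoImplicit false

noncomputable section

open scoped BigOperators

namespace Literature.MathematicalPhysics.QuantumFieldTheory.Balaban1983to89.BlockAveragingEMLProp1Iter

open T4Continuum BlockAveraging AveragingRT B10Eq47AxialChi LatticeWordStokes BlockAveragingEMLProp2 BlockAveragingEMLProp1L1

/-! ## §1 Torus bookkeeping: shifts and blocks re-index sums over the torus -/

section Comb

variable {P : Params} {j : ℕ}

/-- Summing a function over the torus is invariant under the `m`-fold shift (a translation of the finite torus). [folklore] -/
private theorem sum_shiftN {M : Type*} [AddCommMonoid M] (g : Site P j → M) (μ : Fin P.d) (m : ℕ) :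
    ∑ x : Site P j, g (shiftN x μ m) = ∑ x : Site P j, g x := by
  classical
  let v : Fin P.d → ZMod (P.sitesPerDir j) := fun κ => if κ = μ then ((m : ℕ) : ZMod (P.sitesPerDir j)) else 0
  let e : Site P j ≃ Site P j :=
    { toFun := fun x κ => x κ + v κ
      invFun := fun x κ => x κ - v κ
      left_inv := fun x => funext fun κ => add_sub_cancel_right _ _
      right_inv := fun x => funext fun κ => sub_add_cancel _ _ }
  have he : ∀ x : Site P j, shiftN x μ m = e x := fun x => funext fun κ => by
    rw [shiftN_apply]
    rfl
  simp_rw [he]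
  exact Fintype.sum_equiv e _ _ fun x => rfl

/-- The end of the staircase `Γ^σ(off r)` from the block centre `emb y` IS the block site of offset `r` (`emb y + (r − (L−1)∕2) = L·y + r`); private twin of lit
`BlockAveragingEMLLinearised.walkEnd_emb_stairWord_eq_blockSite` (not in this file's import closure). [cite: Balaban1987RG1, (0.3) p.252] -/
private theorem walkEnd_emb_stairWord_off (y : Site P (j + 1)) (σ : Equiv.Perm (Fin P.d)) (r : Fin P.d → Fin P.L) :
    walkEnd (emb y) (stairWord σ (off r)) = Site.blockSite y r := by
  have hL := AveragingRT.two_mul_half_add_one P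
  funext ν
  rw [walkEnd_stairWord_apply]
  have h0 : 0 ≤ (((P.L - 1) / 2 : ℕ) : ℤ) + off r ν := by have := off_bounds r ν; omega
  have hr : ((((P.L - 1) / 2 : ℕ) : ℤ) + off r ν).toNat = r ν := by
    have := (r ν).isLt
    simp only [off]; omega
  have hr' : (y ν).val * P.L + (r ν : ℕ) = (y ν).val * P.L + ((((P.L - 1) / 2 : ℕ) : ℤ) + off r ν).toNat := by rw [hr]
  show (((y ν).val * P.L + (P.L - 1) / 2 : ℕ) : ZMod (P.sitesPerDir j)) + ((off r ν : ℤ) : ZMod (P.sitesPerDir j)) =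
    (((y ν).val * P.L + r ν : ℕ) : ZMod (P.sitesPerDir j))
  set h : ℕ := (P.L - 1) / 2 with hh
  rw [hr', ← Int.cast_natCast (R := ZMod (P.sitesPerDir j)) ((y ν).val * P.L + h), ← Int.cast_add,
    ← Int.cast_natCast (R := ZMod (P.sitesPerDir j)) ((y ν).val * P.L + ((h : ℤ) + off r ν).toNat)]
  congr 1
  push_cast
  rw [Int.toNat_of_nonneg h0]
  ring

/-- **THE BLOCKS PARTITION THE TORUS**: summing over the coarse sites `y` and the offsets `r` of the block sites is summing over the fine torus (standing range; B12 (0.3):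
`B(y)` = «the `L^{d}` points»); private twin of lit `B6Ineq2118LowerMultiLevelV1.sum_blockSite_eq` (not in this file's import closure). [cite: Balaban1987RG1, (0.3) p.252] -/
private theorem sum_sum_blockSite (hj : j + 1 ≤ P.m + P.K) {M : Type*} [AddCommMonoid M] (g : Site P j → M) :
    ∑ y : Site P (j + 1), ∑ r : Fin P.d → Fin P.L, g (Site.blockSite y r) = ∑ x : Site P j, g x := by
  classical
  have h1 : ∀ y : Site P (j + 1), ∑ r : Fin P.d → Fin P.L, g (Site.blockSite y r) = ∑ x ∈ block y, g x :=
    fun y => (B10StarCount.sum_block hj y g).symm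
  simp_rw [h1, block]
  exact Finset.sum_fiberwise_of_maps_to (fun x _ => Finset.mem_univ (blockOf x)) g

/-- **THE CHAIN COUNT OF [Balaban1985UV3] (69)–(70) AS AN IDENTITY**: for every offset pair `(t, s)` of the tiling and every staircase ordering `σ`, summing a function of the tiled
fine site `x_{y,r} + t e_ν + s e_μ` over ALL coarse sites `y` and ALL block offsets `r` is summing it over the fine torus — given `(t, s)` the base point, hence the coarse site,
is DETERMINED; this is why every fine plaquette receives total weight `L^{−d}·L²` per level (the overlap count «each fine plaquette lies in at most `L^{2j}` translates `(p′)_x`»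
behind (70) p.273). [cite: Balaban1985UV3, (69)-(70) p.273] -/
theorem sum_sum_tiledSite (hj : j + 1 ≤ P.m + P.K) {M : Type*} [AddCommMonoid M] (g : Site P j → M) (σ : Equiv.Perm (Fin P.d))
    (μ ν : Fin P.d) (t s : ℕ) :
    ∑ y : Site P (j + 1), ∑ r : Fin P.d → Fin P.L, g (shiftN (shiftN (walkEnd (emb y) (stairWord σ (off r))) ν t) μ s) = ∑ x : Site P j, g x := by
  simp_rw [walkEnd_emb_stairWord_off]
  rw [sum_sum_blockSite hj (fun x => g (shiftN (shiftN x ν t) μ s)), sum_shiftN (fun x => g (shiftN x μ s)) ν t, sum_shiftN g μ s]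

/-- The same with the two tiling offsets summed inside: `Σ_r Σ_y Σ_{t<L} Σ_{s<L} g(x_{y,r} + t e_ν + s e_μ) = L²·Σ_x g x`. [cite: Balaban1985UV3, (69)-(70) p.273] -/
theorem sum_tiled_four (hj : j + 1 ≤ P.m + P.K) (g : Site P j → ℝ) (σ : Equiv.Perm (Fin P.d)) (μ ν : Fin P.d) :
    ∑ r : Fin P.d → Fin P.L, ∑ y : Site P (j + 1), ∑ t ∈ Finset.range P.L, ∑ s ∈ Finset.range P.L,
        g (shiftN (shiftN (walkEnd (emb y) (stairWord σ (off r))) ν t) μ s) = ((P.L : ℝ) * P.L) * ∑ x : Site P j, g x := by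
  calc ∑ r : Fin P.d → Fin P.L, ∑ y : Site P (j + 1), ∑ t ∈ Finset.range P.L, ∑ s ∈ Finset.range P.L,
        g (shiftN (shiftN (walkEnd (emb y) (stairWord σ (off r))) ν t) μ s)
      = ∑ r : Fin P.d → Fin P.L, ∑ t ∈ Finset.range P.L, ∑ y : Site P (j + 1), ∑ s ∈ Finset.range P.L,
        g (shiftN (shiftN (walkEnd (emb y) (stairWord σ (off r))) ν t) μ s) := Finset.sum_congr rfl fun r _ => Finset.sum_comm
    _ = ∑ t ∈ Finset.range P.L, ∑ r : Fin P.d → Fin P.L, ∑ y : Site P (j + 1), ∑ s ∈ Finset.range P.L,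
        g (shiftN (shiftN (walkEnd (emb y) (stairWord σ (off r))) ν t) μ s) := Finset.sum_comm
    _ = ∑ t ∈ Finset.range P.L, ∑ r : Fin P.d → Fin P.L, ∑ s ∈ Finset.range P.L, ∑ y : Site P (j + 1),
        g (shiftN (shiftN (walkEnd (emb y) (stairWord σ (off r))) ν t) μ s) :=
          Finset.sum_congr rfl fun t _ => Finset.sum_congr rfl fun r _ => Finset.sum_comm
    _ = ∑ t ∈ Finset.range P.L, ∑ s ∈ Finset.range P.L, ∑ r : Fin P.d → Fin P.L, ∑ y : Site P (j + 1),
        g (shiftN (shiftN (walkEnd (emb y) (stairWord σ (off r))) ν t) μ s) := Finset.sum_congr rfl fun t _ => Finset.sum_comm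
    _ = ∑ t ∈ Finset.range P.L, ∑ s ∈ Finset.range P.L, ∑ x : Site P j, g x := by
          refine Finset.sum_congr rfl fun t _ => Finset.sum_congr rfl fun s _ => ?_
          rw [Finset.sum_comm]
          exact sum_sum_tiledSite hj g σ μ ν t s
    _ = ((P.L : ℝ) * P.L) * ∑ x : Site P j, g x := by
          rw [Finset.sum_const, Finset.card_range, Finset.sum_const, Finset.card_range, nsmul_eq_mul, nsmul_eq_mul]
          ring

end Comb

/-! ## §2 The `n`-fold `L¹` bound with transport-plan weights -/

section Iter

open ExpMeanLog NormedSpace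
open scoped Matrix.Norms.L2Operator

variable {n : Type*} [Fintype n] [DecidableEq n] [Nonempty n] {P : Params}

/-- The coupled index count: `|J| = L^d · |S_d|⁴`. [folklore] -/
private theorem card_J_eq :
    (Fintype.card ((Fin P.d → Fin P.L) × Equiv.Perm (Fin P.d) × Equiv.Perm (Fin P.d) × Equiv.Perm (Fin P.d) × Equiv.Perm (Fin P.d)) : ℝ) = (P.L : ℝ) ^ P.d * (Fintype.card (Equiv.Perm (Fin P.d) × Equiv.Perm (Fin P.d) × Equiv.Perm (Fin P.d) × Equiv.Perm (Fin P.d)) : ℝ) := by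
  rw [Fintype.card_prod, Fintype.card_fun, Fintype.card_fin, Fintype.card_fin]
  push_cast
  ring

/-- ★★★ **[Balaban1985UV3] (69) FOR THE `N`-FOLD SYMMETRIC AVERAGING (0.4) WITH THE PRINTED `exp[mean log]` — THE `L¹` CHAIN WITH ITS TRANSPORT PLAN.**  Let
`V_j, V_{j+1} = ŪV_j, …, V_{j+N}` be successive (0.4)-averages on the torus (standing range `j + N ≤ m + K`), every plaquette of `V_{j+k}` within `a_k` of `1` with
`s_k := (((d+4)L)²/4)·a_k ≤ δ_N/2` (`k < N`; in print these are Prop. 2's windows (53)).  Then for every orientation `μ < ν` there are WEIGHTS `W(y, z) ≥ 0` (coarse site `y` of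
`T^{(j+N)}`, fine site `z` of `T^{(j)}`) with OUTGOING total `Σ_z W(y, z) ≤ L^{2N}` (the `L^{2N}` finest plaquettes «under» a coarse one), INCOMING total
`Σ_y W(y, z) ≤ L^{−(d−2)N}` (print's overlap count «each fine plaquette lies in at most `L^{2j}` translates `(p′)_x`», (70) p.273, as a transport identity), and
**`|V_{j+N}(∂p′_y) − 1| ≤ Σ_z W(y, z)·|V_j(∂p_z) − 1| + Σ_{k<N} L^{2(N−1−k)}·143·s_k²`** — print's (69) «`|Ū^j(∂p′) − 1| < Σ_{x∈B^j(x₀)} L^{−3j} Σ_{p⊂(p′)_x} |U(∂p) − 1| + O(1)(g_jp(g_j))²`»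
for the averaging of record, whose iterates do not flatten as a formula but whose `L¹` bounds chain (induction over ✓`BlockAveragingEMLProp1L1.dist1_plaqHol_avgFun_le_L1`; the
incoming identity is §1's `sum_sum_tiledSite`).  With `max_z W(y,z) ≤ Σ_y W(y,z) ≤ L^{−(d−2)N}` one Jensen∕Cauchy–Schwarz gives (70) with print's constant `L^{N}` at `d = 3`.
[cite: Balaban1985UV3, (69)-(70) p.273; Balaban1985Averaging, Prop. 1 (50) p.25 and Prop. 2 (53) p.26; Balaban1987RG1, (0.4) p.253] -/
theorem exists_transportWeights (j : ℕ) {μ ν : Fin P.d} (hμν : μ < ν)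
    (V : (k : ℕ) → GaugeField P k (Matrix.specialUnitaryGroup n ℂ)) (a : ℕ → ℝ) (ha : ∀ k, 0 ≤ a k) :
    ∀ N : ℕ, j + N ≤ P.m + P.K →
      (∀ k, k < N → V (j + k + 1) = avgFun (expMeanLogSU (n := n)) (V (j + k))) →
      (∀ k, k < N → ∀ q : Plaq P (j + k), dist1 (GaugeField.plaqHol (V (j + k)) q) ≤ a k) →
      (∀ k, k < N → ((((P.d + 4) * P.L : ℕ) : ℝ) ^ 2 / 4) * a k ≤ deltaSU n / 2) →
      ∃ W : Site P (j + N) → Site P j → ℝ,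
        (∀ y z, 0 ≤ W y z) ∧
        (∀ y, ∑ z, W y z ≤ ((P.L : ℝ) ^ 2) ^ N) ∧
        (∀ z, ∑ y, W y z ≤ (((P.L : ℝ) ^ (P.d - 2))⁻¹) ^ N) ∧
        ∀ y, dist1 (GaugeField.plaqHol (V (j + N)) ⟨y, μ, ν, hμν⟩) ≤
          ∑ z, W y z * dist1 (GaugeField.plaqHol (V j) ⟨z, μ, ν, hμν⟩) +
            ∑ k ∈ Finset.range N, ((P.L : ℝ) ^ 2) ^ (N - 1 - k) * (143 * (((((P.d + 4) * P.L : ℕ) : ℝ) ^ 2 / 4) * a k) ^ 2) := by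
  classical
  intro N
  induction N with
  | zero =>
    intro _ _ _ _
    refine ⟨fun y z => if z = y then 1 else 0, fun y z => by positivity, fun y => ?_, fun z => ?_, fun y => ?_⟩
    · simp
    · simp
    · simp
  | succ N ih =>
    intro hrange hV hVa hs
    obtain ⟨W, hW0, hWout, hWin, hWmain⟩ := ih (by omega) (fun k hk => hV k (by omega)) (fun k hk => hVa k (by omega)) (fun k hk => hs k (by omega))
    -- constants
    have hL0 : (0 : ℝ) < P.L := by exact_mod_cast P.L_pos
    have hd2 : 2 ≤ P.d := by have := hμν; have := ν.isLt; omega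
    haveI : Nonempty (Fin P.d → Fin P.L) := ⟨fun _ => ⟨0, P.L_pos⟩⟩
    have hcardJ' : (0 : ℝ) < (Fintype.card (Equiv.Perm (Fin P.d) × Equiv.Perm (Fin P.d) × Equiv.Perm (Fin P.d) × Equiv.Perm (Fin P.d)) : ℝ) := Nat.cast_pos.mpr Fintype.card_pos
    have hcardJ : (0 : ℝ) < (Fintype.card ((Fin P.d → Fin P.L) × Equiv.Perm (Fin P.d) × Equiv.Perm (Fin P.d) × Equiv.Perm (Fin P.d) × Equiv.Perm (Fin P.d)) : ℝ) := Nat.cast_pos.mpr Fintype.card_pos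
    set c : ℝ := (Fintype.card ((Fin P.d → Fin P.L) × Equiv.Perm (Fin P.d) × Equiv.Perm (Fin P.d) × Equiv.Perm (Fin P.d) × Equiv.Perm (Fin P.d)) : ℝ) with hc
    set E : ℝ := ∑ k ∈ Finset.range N, ((P.L : ℝ) ^ 2) ^ (N - 1 - k) * (143 * (((((P.d + 4) * P.L : ℕ) : ℝ) ^ 2 / 4) * a k) ^ 2) with hE
    set sN : ℝ := ((((P.d + 4) * P.L : ℕ) : ℝ) ^ 2 / 4) * a N with hsN
    -- the new weights: average over the coupled index and the tiling of the old weights at the tiled sites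
    refine ⟨fun y z => c⁻¹ * ∑ J : ((Fin P.d → Fin P.L) × Equiv.Perm (Fin P.d) × Equiv.Perm (Fin P.d) × Equiv.Perm (Fin P.d) × Equiv.Perm (Fin P.d)), ∑ t ∈ Finset.range P.L, ∑ s ∈ Finset.range P.L,
        W (shiftN (shiftN (walkEnd (emb y) (stairWord J.2.1 (off J.1))) ν t) μ s) z, ?_, ?_, ?_, ?_⟩
    · -- nonnegativity
      intro y z
      exact mul_nonneg (inv_nonneg.mpr hcardJ.le) (Finset.sum_nonneg fun J _ => Finset.sum_nonneg fun t _ => Finset.sum_nonneg fun s _ => hW0 _ _)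
    · -- outgoing total: `L²` tiles per square, mean over the index
      intro y
      beta_reduce
      rw [← Finset.mul_sum, Finset.sum_comm]
      have hin : ∀ J : ((Fin P.d → Fin P.L) × Equiv.Perm (Fin P.d) × Equiv.Perm (Fin P.d) × Equiv.Perm (Fin P.d) × Equiv.Perm (Fin P.d)), ∑ z, ∑ t ∈ Finset.range P.L, ∑ s ∈ Finset.range P.L,
          W (shiftN (shiftN (walkEnd (emb y) (stairWord J.2.1 (off J.1))) ν t) μ s) z ≤ (P.L : ℝ) * ((P.L : ℝ) * ((P.L : ℝ) ^ 2) ^ N) := by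
        intro J
        rw [Finset.sum_comm]
        refine (Finset.sum_le_sum fun t _ => ?_).trans (by rw [Finset.sum_const, Finset.card_range, nsmul_eq_mul])
        rw [Finset.sum_comm]
        refine (Finset.sum_le_sum fun s _ => hWout _).trans (by rw [Finset.sum_const, Finset.card_range, nsmul_eq_mul])
      calc c⁻¹ * ∑ J : ((Fin P.d → Fin P.L) × Equiv.Perm (Fin P.d) × Equiv.Perm (Fin P.d) × Equiv.Perm (Fin P.d) × Equiv.Perm (Fin P.d)), ∑ z, ∑ t ∈ Finset.range P.L, ∑ s ∈ Finset.range P.L,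
            W (shiftN (shiftN (walkEnd (emb y) (stairWord J.2.1 (off J.1))) ν t) μ s) z
          ≤ c⁻¹ * ∑ _J : ((Fin P.d → Fin P.L) × Equiv.Perm (Fin P.d) × Equiv.Perm (Fin P.d) × Equiv.Perm (Fin P.d) × Equiv.Perm (Fin P.d)), (P.L : ℝ) * ((P.L : ℝ) * ((P.L : ℝ) ^ 2) ^ N) :=
            mul_le_mul_of_nonneg_left (Finset.sum_le_sum fun J _ => hin J) (inv_nonneg.mpr hcardJ.le)
        _ = ((P.L : ℝ) ^ 2) ^ (N + 1) := by
            rw [Finset.sum_const, Finset.card_univ, nsmul_eq_mul, ← hc, ← mul_assoc, inv_mul_cancel₀ hcardJ.ne', one_mul]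
            ring
    · -- incoming total: the chain count (§1) — given the tiling offsets the base point, hence the coarse site, is determined
      intro z
      have hlev : j + N + 1 ≤ P.m + P.K := by omega
      have hreorg : ∑ y : Site P (j + (N + 1)), c⁻¹ * ∑ J : ((Fin P.d → Fin P.L) × Equiv.Perm (Fin P.d) × Equiv.Perm (Fin P.d) × Equiv.Perm (Fin P.d) × Equiv.Perm (Fin P.d)), ∑ t ∈ Finset.range P.L, ∑ s ∈ Finset.range P.L,
            W (shiftN (shiftN (walkEnd (emb y) (stairWord J.2.1 (off J.1))) ν t) μ s) z =
          c⁻¹ * ∑ _J' : (Equiv.Perm (Fin P.d) × Equiv.Perm (Fin P.d) × Equiv.Perm (Fin P.d) × Equiv.Perm (Fin P.d)), ((P.L : ℝ) * P.L) * ∑ x : Site P (j + N), W x z := by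
        rw [← Finset.mul_sum, Finset.sum_comm, Fintype.sum_prod_type, Finset.sum_comm]
        congr 1
        refine Finset.sum_congr rfl fun J' _ => ?_
        exact sum_tiled_four hlev (fun x => W x z) J'.1 μ ν
      beta_reduce
      rw [hreorg, Finset.sum_const, Finset.card_univ, nsmul_eq_mul]
      have hX := hWin z
      have hcJ : c = (P.L : ℝ) ^ P.d * (Fintype.card (Equiv.Perm (Fin P.d) × Equiv.Perm (Fin P.d) × Equiv.Perm (Fin P.d) × Equiv.Perm (Fin P.d)) : ℝ) := card_J_eq
      have hpow : (P.L : ℝ) ^ P.d = (P.L : ℝ) ^ (P.d - 2) * ((P.L : ℝ) * P.L) := by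
        rw [← pow_two, ← pow_add, Nat.sub_add_cancel hd2]
      have hLd2 : (0 : ℝ) < (P.L : ℝ) ^ (P.d - 2) := pow_pos hL0 _
      calc c⁻¹ * ((Fintype.card (Equiv.Perm (Fin P.d) × Equiv.Perm (Fin P.d) × Equiv.Perm (Fin P.d) × Equiv.Perm (Fin P.d)) : ℝ) * (((P.L : ℝ) * P.L) * ∑ x : Site P (j + N), W x z))
          ≤ c⁻¹ * ((Fintype.card (Equiv.Perm (Fin P.d) × Equiv.Perm (Fin P.d) × Equiv.Perm (Fin P.d) × Equiv.Perm (Fin P.d)) : ℝ) * (((P.L : ℝ) * P.L) * (((P.L : ℝ) ^ (P.d - 2))⁻¹) ^ N)) := by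
            gcongr
        _ = (((P.L : ℝ) ^ (P.d - 2))⁻¹) ^ (N + 1) := by
            rw [hcJ, hpow]
            set A : ℝ := (P.L : ℝ) ^ (P.d - 2) with hA
            set K : ℝ := (Fintype.card (Equiv.Perm (Fin P.d) × Equiv.Perm (Fin P.d) × Equiv.Perm (Fin P.d) × Equiv.Perm (Fin P.d)) : ℝ) with hK
            have hA0 : A ≠ 0 := hLd2.ne'
            have hK0 : K ≠ 0 := hcardJ'.ne'
            have hL1 : (P.L : ℝ) ≠ 0 := hL0.ne'
            rw [pow_succ]
            field_simp
    · -- the chained bound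
      intro y
      have hlev : j + N + 1 ≤ P.m + P.K := by omega
      -- one step at the top (✓`dist1_plaqHol_avgFun_le_L1` at level `j + N`)
      have h1 := dist1_plaqHol_avgFun_le_L1 (ha N) (hVa N (lt_add_one N)) (hs N (lt_add_one N)) y hμν
      rw [← hV N (lt_add_one N)] at h1
      -- the induction hypothesis under the mean
      have h2 : c⁻¹ * ∑ J : ((Fin P.d → Fin P.L) × Equiv.Perm (Fin P.d) × Equiv.Perm (Fin P.d) × Equiv.Perm (Fin P.d) × Equiv.Perm (Fin P.d)), ∑ t ∈ Finset.range P.L, ∑ s ∈ Finset.range P.L,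
            dist1 (GaugeField.plaqHol (V (j + N)) ⟨shiftN (shiftN (walkEnd (emb y) (stairWord J.2.1 (off J.1))) ν t) μ s, μ, ν, hμν⟩) ≤
          c⁻¹ * ∑ J : ((Fin P.d → Fin P.L) × Equiv.Perm (Fin P.d) × Equiv.Perm (Fin P.d) × Equiv.Perm (Fin P.d) × Equiv.Perm (Fin P.d)), ∑ t ∈ Finset.range P.L, ∑ s ∈ Finset.range P.L,
            ((∑ z, W (shiftN (shiftN (walkEnd (emb y) (stairWord J.2.1 (off J.1))) ν t) μ s) z * dist1 (GaugeField.plaqHol (V j) ⟨z, μ, ν, hμν⟩)) + E) :=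
        mul_le_mul_of_nonneg_left (Finset.sum_le_sum fun J _ => Finset.sum_le_sum fun t _ => Finset.sum_le_sum fun s _ => hWmain _)
          (inv_nonneg.mpr hcardJ.le)
      -- the constant part: `|J|·L²` copies of `E`
      have h3 : c⁻¹ * ∑ J : ((Fin P.d → Fin P.L) × Equiv.Perm (Fin P.d) × Equiv.Perm (Fin P.d) × Equiv.Perm (Fin P.d) × Equiv.Perm (Fin P.d)), ∑ t ∈ Finset.range P.L, ∑ s ∈ Finset.range P.L,
            ((∑ z, W (shiftN (shiftN (walkEnd (emb y) (stairWord J.2.1 (off J.1))) ν t) μ s) z * dist1 (GaugeField.plaqHol (V j) ⟨z, μ, ν, hμν⟩)) + E) =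
          c⁻¹ * ∑ J : ((Fin P.d → Fin P.L) × Equiv.Perm (Fin P.d) × Equiv.Perm (Fin P.d) × Equiv.Perm (Fin P.d) × Equiv.Perm (Fin P.d)), ∑ t ∈ Finset.range P.L, ∑ s ∈ Finset.range P.L,
            (∑ z, W (shiftN (shiftN (walkEnd (emb y) (stairWord J.2.1 (off J.1))) ν t) μ s) z * dist1 (GaugeField.plaqHol (V j) ⟨z, μ, ν, hμν⟩)) +
          ((P.L : ℝ) * P.L) * E := by
        simp only [Finset.sum_add_distrib, mul_add]
        congr 1
        simp only [Finset.sum_const, Finset.card_range, Finset.card_univ, nsmul_eq_mul]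
        rw [← hc]
        field_simp
      -- the weighted part is the new weights' sum
      have h4 : c⁻¹ * ∑ J : ((Fin P.d → Fin P.L) × Equiv.Perm (Fin P.d) × Equiv.Perm (Fin P.d) × Equiv.Perm (Fin P.d) × Equiv.Perm (Fin P.d)), ∑ t ∈ Finset.range P.L, ∑ s ∈ Finset.range P.L,
            (∑ z, W (shiftN (shiftN (walkEnd (emb y) (stairWord J.2.1 (off J.1))) ν t) μ s) z * dist1 (GaugeField.plaqHol (V j) ⟨z, μ, ν, hμν⟩)) =
          ∑ z, (c⁻¹ * ∑ J : ((Fin P.d → Fin P.L) × Equiv.Perm (Fin P.d) × Equiv.Perm (Fin P.d) × Equiv.Perm (Fin P.d) × Equiv.Perm (Fin P.d)), ∑ t ∈ Finset.range P.L, ∑ s ∈ Finset.range P.L,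
            W (shiftN (shiftN (walkEnd (emb y) (stairWord J.2.1 (off J.1))) ν t) μ s) z) * dist1 (GaugeField.plaqHol (V j) ⟨z, μ, ν, hμν⟩) := by
        symm
        simp only [mul_assoc, ← Finset.mul_sum, Finset.sum_mul]
        congr 1
        rw [Finset.sum_comm]
        refine Finset.sum_congr rfl fun J _ => ?_
        rw [Finset.sum_comm]
        refine Finset.sum_congr rfl fun t _ => ?_
        exact Finset.sum_comm
      -- the error recursion `E_{N+1} = L²·E_N + 143·s_N²`
      have h5 : ((P.L : ℝ) * P.L) * E + 143 * sN ^ 2 =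
          ∑ k ∈ Finset.range (N + 1), ((P.L : ℝ) ^ 2) ^ (N + 1 - 1 - k) * (143 * (((((P.d + 4) * P.L : ℕ) : ℝ) ^ 2 / 4) * a k) ^ 2) := by
        rw [Finset.sum_range_succ, hE, hsN, Finset.mul_sum]
        congr 1
        · refine Finset.sum_congr rfl fun k hk => ?_
          have hk' : k < N := Finset.mem_range.mp hk
          have e : N + 1 - 1 - k = (N - 1 - k) + 1 := by omega
          rw [e, pow_succ]
          ring
        · have e : N + 1 - 1 - N = 0 := by omega
          rw [e, pow_zero, one_mul]
      calc dist1 (GaugeField.plaqHol (V (j + N + 1)) ⟨y, μ, ν, hμν⟩)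
          ≤ c⁻¹ * ∑ J : ((Fin P.d → Fin P.L) × Equiv.Perm (Fin P.d) × Equiv.Perm (Fin P.d) × Equiv.Perm (Fin P.d) × Equiv.Perm (Fin P.d)), ∑ t ∈ Finset.range P.L, ∑ s ∈ Finset.range P.L,
              dist1 (GaugeField.plaqHol (V (j + N)) ⟨shiftN (shiftN (walkEnd (emb y) (stairWord J.2.1 (off J.1))) ν t) μ s, μ, ν, hμν⟩) +
            143 * sN ^ 2 := h1
        _ ≤ c⁻¹ * ∑ J : ((Fin P.d → Fin P.L) × Equiv.Perm (Fin P.d) × Equiv.Perm (Fin P.d) × Equiv.Perm (Fin P.d) × Equiv.Perm (Fin P.d)), ∑ t ∈ Finset.range P.L, ∑ s ∈ Finset.range P.L,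
              ((∑ z, W (shiftN (shiftN (walkEnd (emb y) (stairWord J.2.1 (off J.1))) ν t) μ s) z * dist1 (GaugeField.plaqHol (V j) ⟨z, μ, ν, hμν⟩)) + E) +
            143 * sN ^ 2 := by gcongr
        _ = ∑ z, (c⁻¹ * ∑ J : ((Fin P.d → Fin P.L) × Equiv.Perm (Fin P.d) × Equiv.Perm (Fin P.d) × Equiv.Perm (Fin P.d) × Equiv.Perm (Fin P.d)), ∑ t ∈ Finset.range P.L, ∑ s ∈ Finset.range P.L,
              W (shiftN (shiftN (walkEnd (emb y) (stairWord J.2.1 (off J.1))) ν t) μ s) z) * dist1 (GaugeField.plaqHol (V j) ⟨z, μ, ν, hμν⟩) +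
            (((P.L : ℝ) * P.L) * E + 143 * sN ^ 2) := by rw [h3, h4, add_assoc]
        _ = _ := by rw [h5]

end Iter

/-! ## §3 (70): squaring with the transport plan — ONE Cauchy–Schwarz at the end, print's multiplicity constant -/

section Seventy

variable {α β : Type*} [Fintype α] [Fintype β]

omit [Fintype α] in
/-- **(70), ONE COARSE PLAQUETTE**: for weights `W ≥ 0` with outgoing total `Σ_z W(y,z) ≤ A`, `(Σ_z W(y,z)·d_z)² ≤ A·Σ_z W(y,z)·d_z²` (Cauchy–Schwarz∕Jensen on the plan;
print: «Squaring both sides of the above inequality … yields (70)», the first `≤` of (70) p.273). [cite: Balaban1985UV3, (70) p.273] -/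
theorem sq_weightedSum_le (W : α → β → ℝ) (hW0 : ∀ y z, 0 ≤ W y z) {A : ℝ} (hA : ∀ y, ∑ z, W y z ≤ A) (d : β → ℝ) (y : α) :
    (∑ z, W y z * d z) ^ 2 ≤ A * ∑ z, W y z * d z ^ 2 := by
  have hcs := Finset.sum_sq_le_sum_mul_sum_of_sq_le_mul (Finset.univ : Finset β) (r := fun z => W y z * d z) (f := fun z => W y z)
    (g := fun z => W y z * d z ^ 2) (fun z _ => hW0 y z) (fun z _ => mul_nonneg (hW0 y z) (sq_nonneg _)) (fun z _ => le_of_eq (by ring))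
  exact hcs.trans (mul_le_mul_of_nonneg_right (hA y) (Finset.sum_nonneg fun z _ => mul_nonneg (hW0 y z) (sq_nonneg _)))

/-- **(70), ALL COARSE PLAQUETTES AT ONCE**: with outgoing totals `≤ A` and INCOMING totals `Σ_y W(y,z) ≤ B`, `Σ_y (Σ_z W(y,z)·d_z)² ≤ A·B·Σ_z d_z²` — the second `≤` of (70)
p.273 («each fine plaquette lies in at most `L^{2j}` translates») summed over the coarse plaquettes, with the overlap accounted EXACTLY by the incoming total (no region `Δ′`, no
overlap constant). [cite: Balaban1985UV3, (70)-(71) p.273] -/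
theorem sum_sq_weightedSum_le (W : α → β → ℝ) (hW0 : ∀ y z, 0 ≤ W y z) {A B : ℝ} (hA : ∀ y, ∑ z, W y z ≤ A) (hB : ∀ z, ∑ y, W y z ≤ B)
    (hA0 : 0 ≤ A) (d : β → ℝ) :
    ∑ y, (∑ z, W y z * d z) ^ 2 ≤ A * B * ∑ z, d z ^ 2 := by
  calc ∑ y, (∑ z, W y z * d z) ^ 2 ≤ ∑ y, A * ∑ z, W y z * d z ^ 2 := Finset.sum_le_sum fun y _ => sq_weightedSum_le W hW0 hA d y
    _ = A * ∑ z, (∑ y, W y z) * d z ^ 2 := by rw [← Finset.mul_sum, Finset.sum_comm]; simp_rw [Finset.sum_mul]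
    _ ≤ A * ∑ z, B * d z ^ 2 := mul_le_mul_of_nonneg_left (Finset.sum_le_sum fun z _ => mul_le_mul_of_nonneg_right (hB z) (sq_nonneg _)) hA0
    _ = A * B * ∑ z, d z ^ 2 := by rw [← Finset.mul_sum, mul_assoc]

/-- **(70) AT ONE COARSE PLAQUETTE WITH THE INCOMING BOUND AS THE MULTIPLICITY**: `(Σ_z W(y,z)·d_z)² ≤ A·B·Σ_z d_z²` (since `W(y,z) ≤ Σ_{y′} W(y′,z) ≤ B`).  At `d = 3` with
✓`exists_transportWeights` (`A = L^{2N}`, `B = L^{−N}`): `|V_{j+N}(∂p′) − 1|² ≲ L^{N}·Σ_q |V_j(∂q) − 1|²` — print's constant. [cite: Balaban1985UV3, (70) p.273] -/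
theorem sq_weightedSum_le_mul (W : α → β → ℝ) (hW0 : ∀ y z, 0 ≤ W y z) {A B : ℝ} (hA : ∀ y, ∑ z, W y z ≤ A) (hB : ∀ z, ∑ y, W y z ≤ B)
    (hA0 : 0 ≤ A) (d : β → ℝ) (y : α) :
    (∑ z, W y z * d z) ^ 2 ≤ A * B * ∑ z, d z ^ 2 := by
  have hWB : ∀ z, W y z ≤ B := fun z => (Finset.single_le_sum (fun y' _ => hW0 y' z) (Finset.mem_univ y)).trans (hB z)
  calc (∑ z, W y z * d z) ^ 2 ≤ A * ∑ z, W y z * d z ^ 2 := sq_weightedSum_le W hW0 hA d y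
    _ ≤ A * ∑ z, B * d z ^ 2 := mul_le_mul_of_nonneg_left (Finset.sum_le_sum fun z _ => mul_le_mul_of_nonneg_right (hWB z) (sq_nonneg _)) hA0
    _ = A * B * ∑ z, d z ^ 2 := by rw [← Finset.mul_sum, mul_assoc]

end Seventy

end Literature.MathematicalPhysics.QuantumFieldTheory.Balaban1983to89.BlockAveragingEMLProp1Iter

end
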